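import Literature.NumberTheory.LFunctions.WeilFirstPrimeCertificateCRows0x0
import Literature.NumberTheory.LFunctions.WeilFirstPrimeCertificateCRows0x1
import Literature.NumberTheory.LFunctions.WeilFirstPrimeCertificateCRows0x2
import Literature.NumberTheory.LFunctions.WeilFirstPrimeCertificateCRows0x3
import Literature.NumberTheory.LFunctions.WeilFirstPrimeCertificateCRows0x4
import Literature.NumberTheory.LFunctions.WeilFirstPrimeCertificateCRows0x5
import Literature.NumberTheory.LFunctions.WeilFirstPrimeCertificateCRows0x6
import Literature.NumberTheory.LFunctions.WeilFirstPrimeCertificateCRows0x7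
import Literature.NumberTheory.LFunctions.WeilFirstPrimeCertificateCRows0x8
import Literature.NumberTheory.LFunctions.WeilFirstPrimeCertificateCRows0x9
import Literature.NumberTheory.LFunctions.WeilFirstPrimeCertificateCRows0x10
import Literature.NumberTheory.LFunctions.WeilFirstPrimeCertificateCRows0x11
import Literature.NumberTheory.LFunctions.WeilFirstPrimeCertificateCRows0x12
import Literature.NumberTheory.LFunctions.WeilFirstPrimeCertificateCRows0x13
import Literature.NumberTheory.LFunctions.WeilFirstPrimeCertificateCRows0x14
import Literature.NumberTheory.LFunctions.WeilFirstPrimeCertificateCRows0x15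
import Literature.NumberTheory.LFunctions.WeilFirstPrimeCertificateCRows0x16
import Literature.NumberTheory.LFunctions.WeilFirstPrimeCertificateCKappa
import Literature.NumberTheory.LFunctions.WeilBlockRows
import HarnessLib

/-!
# First-prime Weil positivity, stage C: the parity block `Block0` from its rows

`weilCert3C.base.checkBlockK … 0 = true` assembled from the row-wise kernel checks
(`WeilCert.checkBlockK_of_rows`, `WeilBlockRows.lean`). Pure proof file; nothing is asserted.
-/

noncomputable section

namespace Literature.NumberTheory.LFunctions

/-- **The parity-0 block check** (`D C = I`, `S' − UᵀU` diagonally dominant) of the stage-C first-prime certificate, assembled from its kernel-checked rows (`WeilCert.checkBlockK_of_rows`). [folklore] -/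
theorem checkBlock0_weilCert3C : weilCert3C.base.checkBlockK weilCert3C.nuTab weilCert3C.kappaQ 0 = true := by
  rw [nuTab_weilCert3C, kappaQ_weilCert3C]
  refine WeilCert.checkBlockK_of_rows (fun i hi ↦ ?_) (fun i hi ↦ ?_)
  · have hi' : i < 50 := hi
    interval_cases i
    · exact checkDCRow0_0_weilCert3C
    · exact checkDCRow0_1_weilCert3C
    · exact checkDCRow0_2_weilCert3C
    · exact checkDCRow0_3_weilCert3C
    · exact checkDCRow0_4_weilCert3C
    · exact checkDCRow0_5_weilCert3C
    · exact checkDCRow0_6_weilCert3C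
    · exact checkDCRow0_7_weilCert3C
    · exact checkDCRow0_8_weilCert3C
    · exact checkDCRow0_9_weilCert3C
    · exact checkDCRow0_10_weilCert3C
    · exact checkDCRow0_11_weilCert3C
    · exact checkDCRow0_12_weilCert3C
    · exact checkDCRow0_13_weilCert3C
    · exact checkDCRow0_14_weilCert3C
    · exact checkDCRow0_15_weilCert3C
    · exact checkDCRow0_16_weilCert3C
    · exact checkDCRow0_17_weilCert3C
    · exact checkDCRow0_18_weilCert3C
    · exact checkDCRow0_19_weilCert3C
    · exact checkDCRow0_20_weilCert3C
    · exact checkDCRow0_21_weilCert3C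
    · exact checkDCRow0_22_weilCert3C
    · exact checkDCRow0_23_weilCert3C
    · exact checkDCRow0_24_weilCert3C
    · exact checkDCRow0_25_weilCert3C
    · exact checkDCRow0_26_weilCert3C
    · exact checkDCRow0_27_weilCert3C
    · exact checkDCRow0_28_weilCert3C
    · exact checkDCRow0_29_weilCert3C
    · exact checkDCRow0_30_weilCert3C
    · exact checkDCRow0_31_weilCert3C
    · exact checkDCRow0_32_weilCert3C
    · exact checkDCRow0_33_weilCert3C
    · exact checkDCRow0_34_weilCert3C
    · exact checkDCRow0_35_weilCert3C
    · exact checkDCRow0_36_weilCert3C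
    · exact checkDCRow0_37_weilCert3C
    · exact checkDCRow0_38_weilCert3C
    · exact checkDCRow0_39_weilCert3C
    · exact checkDCRow0_40_weilCert3C
    · exact checkDCRow0_41_weilCert3C
    · exact checkDCRow0_42_weilCert3C
    · exact checkDCRow0_43_weilCert3C
    · exact checkDCRow0_44_weilCert3C
    · exact checkDCRow0_45_weilCert3C
    · exact checkDCRow0_46_weilCert3C
    · exact checkDCRow0_47_weilCert3C
    · exact checkDCRow0_48_weilCert3C
    · exact checkDCRow0_49_weilCert3C
  · have hi' : i < 50 := hi
    interval_cases i
    · exact checkDomRow0_0_weilCert3C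
    · exact checkDomRow0_1_weilCert3C
    · exact checkDomRow0_2_weilCert3C
    · exact checkDomRow0_3_weilCert3C
    · exact checkDomRow0_4_weilCert3C
    · exact checkDomRow0_5_weilCert3C
    · exact checkDomRow0_6_weilCert3C
    · exact checkDomRow0_7_weilCert3C
    · exact checkDomRow0_8_weilCert3C
    · exact checkDomRow0_9_weilCert3C
    · exact checkDomRow0_10_weilCert3C
    · exact checkDomRow0_11_weilCert3C
    · exact checkDomRow0_12_weilCert3C
    · exact checkDomRow0_13_weilCert3C
    · exact checkDomRow0_14_weilCert3C
    · exact checkDomRow0_15_weilCert3C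
    · exact checkDomRow0_16_weilCert3C
    · exact checkDomRow0_17_weilCert3C
    · exact checkDomRow0_18_weilCert3C
    · exact checkDomRow0_19_weilCert3C
    · exact checkDomRow0_20_weilCert3C
    · exact checkDomRow0_21_weilCert3C
    · exact checkDomRow0_22_weilCert3C
    · exact checkDomRow0_23_weilCert3C
    · exact checkDomRow0_24_weilCert3C
    · exact checkDomRow0_25_weilCert3C
    · exact checkDomRow0_26_weilCert3C
    · exact checkDomRow0_27_weilCert3C
    · exact checkDomRow0_28_weilCert3C
    · exact checkDomRow0_29_weilCert3C
    · exact checkDomRow0_30_weilCert3C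
    · exact checkDomRow0_31_weilCert3C
    · exact checkDomRow0_32_weilCert3C
    · exact checkDomRow0_33_weilCert3C
    · exact checkDomRow0_34_weilCert3C
    · exact checkDomRow0_35_weilCert3C
    · exact checkDomRow0_36_weilCert3C
    · exact checkDomRow0_37_weilCert3C
    · exact checkDomRow0_38_weilCert3C
    · exact checkDomRow0_39_weilCert3C
    · exact checkDomRow0_40_weilCert3C
    · exact checkDomRow0_41_weilCert3C
    · exact checkDomRow0_42_weilCert3C
    · exact checkDomRow0_43_weilCert3C
    · exact checkDomRow0_44_weilCert3C
    · exact checkDomRow0_45_weilCert3C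
    · exact checkDomRow0_46_weilCert3C
    · exact checkDomRow0_47_weilCert3C
    · exact checkDomRow0_48_weilCert3C
    · exact checkDomRow0_49_weilCert3C

end Literature.NumberTheory.LFunctions
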